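import Summits.QuantumFields.YangMills.Theorems.BalabanUVNodesN15KingModelGraphPowerCountingLogSubgraphs
import Summits.QuantumFields.YangMills.Theorems.BalabanUVNodesN15KingModelGraphPowerCountingSparseCert

/-!
# BalabanUVNodes ∕ N15 — THE KING-MODEL RUNG (PART Δ-h): **DECIDABLE CERTIFICATES FOR KING's FULL LINE ALPHABET (`G` AND `∂G`)** — the integer form of the subgraph
# condition with derivative lines, `(d−1)·|S| + #∂G(S) + d + 2 ≤ (d+1)·|V(S)|` (positive degree) resp. `… + d + 1 ≤ …` (non-negative degree), gives Proposition 3.6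
# (3.56) OUTRIGHT resp. the logarithmic size bound for every explicit connected graph of `G`∕`∂G` lines by `decide`; worked: a triangle with one `∂G` line in four
# dimensions (degree `1`: (3.56) outright) and King's three-dimensional `G∂G` bubble (degree `0`: bounded by `const·(k+1)²`)
# (Track A, DAG node N15 = NE2; FAN-OUT v1.1 §N15 s3 «KING-MODEL RUNG … NE2's analogue DECIDED in the model»)

HONEST FRAMING.  Count-neutral (cell `pub-ymgap`, seat `pub-ymgap-dag-n15-e` g28; `--supports stmt-QuantumFields-27366 --as helper` = K3⁸
`SpineGivenEndpointR13SepCoPHV`).  TEMPLATE LITERATURE: C. King, *The U(1) Higgs model. I. The continuum limit*, Commun. Math. Phys. **102** (1986) 649–677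
[King1986], Prop. 3.6 (3.56) p. 662, Prop. 3.7 (3.63) p. 663 (exponents `2 − d` for `G`, `1 − d` for `∂G`), §3.4 p. 664, §3.5 p. 666.  Parts Δ-e∕Λ-b gave integer
certificates for `G`-lines only.  THIS FILE adds the derivative count `dLines κ S` (part Δ-c): `D(S) = (d+1)(|V(S)| − 1) + (2 − (d+1))|S| − #∂G(S)`, so the
certificates with `#∂G(S)` decide King's subgraph condition for his full two-letter line alphabet, and parts Δ-b (Prop. 3.6 under the subgraph condition) and Λ-b
(size up to logarithms under the non-negative condition) apply by name.  King's U(1)∕`A = 0` MODEL; NOT Bałaban's non-abelian `G(U)` of [B9]; NOT a node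
discharge; nothing continuum ∕ ℝ⁴ ∕ OS ∕ mass-gap ∕ Clay.  0 `sorry`; standard axioms; `decide` on graphs with `≤ 3` lines.
THE PRINT.  p. 663 [PDF 15], (3.63); p. 664 [PDF 16]: *«it is necessary that every subgraph have positive degree D»*; p. 666 [PDF 18]: *«with the possible addition
of some power of ln(L^kε)^{−1}»*.
WHAT THIS FILE PROVES.
* §1 (ns `…Curved`) `subDeg_lineExp_eq_card` (`D(S) = dd(|V(S)|−1) + (2 − dd)|S| − #∂G(S)`), ★ `posSubgraphsBy_lineExp_of_cert` (strict integer certificate with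
  `dLines` ⇒ `PosSubgraphsBy src tgt 0 dd (lineExp ∘ κ)`), ★ `nonnegSubgraphs_lineExp_of_cert` (non-strict ⇒ `NonnegSubgraphs`).
* §2 ★★★ **`king_prop36_graph_zeroField_mixedCert`** — Prop. 3.6 (3.56) OUTRIGHT for connected graphs of `G`∕`∂G` lines under the strict certificate (`1 ≤ d`);
  ★★★ **`king_graph_size_log_zeroField_mixedCert`** — the size up to `m!·(k+1)^m` under the non-strict certificate.
* §3 examples (ns `…Graph` data, `…Curved` theorems): `dTriKind` (the triangle `triSrc`∕`triTgt` of part Γ-j with line `0` a `∂G` line), `cert_dTriangle_three` (`d = 3`,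
  by `decide`), ★★ **`king_prop36_graph_zeroField_dTriangle`** (a loop AND a derivative line, `d + 1 = 4`: (3.56) outright); `gdgKind` on part Δ-e's bubble
  `bubSrc`∕`bubTgt` (one `G`, one `∂G` line), `nonnegCert_GdG_two` (`d = 2`, by `decide`), ★★ **`king_graph_size_log_GdG`** (King's 3-d `G∂G` bubble, degree
  `3 − 1 − 2 = 0` — part Δ-c's negative census: `≤ const·(k+1)²`).
HONEST SCOPE.  Certificates are sufficient conditions checked over all non-empty line sets; King's renormalised graph families ([Ba3]) NOT typed; upper bounds only
for the degree-`0` graphs; NE2∕N15 of record untouched; counts unmoved.  Locators: [King1986] (3.63) p.663, p.664, p.666.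
-/
noncomputable section

namespace Summit.QuantumFields.YangMills.BalabanUVNodes.N15KingModelRung.Graph

open Summit.QuantumFields.YangMills.BalabanUVNodes.N15KingModelRung.Curved (triSrc triTgt)

/-! ## §3 (data) The example graphs' line kinds -/

section Data

/-- the triangle of part Γ-j with line `0` (`{0,1}`) a `∂G` line (direction `0`) and lines `1`, `2` plain `G` lines, in `d + 1 = 4`. [cite: King1986, (3.63) p.663] -/
def dTriKind : Fin 3 → Option (Fin (3 + 1)) := ![some 0, none, none]

/-- King's `G∂G` bubble on part Δ-e's two parallel lines `0 → 1`: line `0` a `G` line, line `1` a `∂G` line (direction `0`), in `d + 1 = 3`.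
[cite: King1986, (3.63) p.663, (3.81) p.667] -/
def gdgKind : Fin 2 → Option (Fin (2 + 1)) := ![none, some 0]

end Data

end Summit.QuantumFields.YangMills.BalabanUVNodes.N15KingModelRung.Graph

namespace Summit.QuantumFields.YangMills.BalabanUVNodes.N15KingModelRung.Curved

open scoped BigOperators
open Finset
open Literature.MathematicalPhysics.QuantumFieldTheory.Balaban1983to89.B5Prop11Plancherel (Tor fine unitVec)
open Summit.QuantumFields.YangMills.BalabanUVNodes.N15KingModelRung (KingVolIndex kingVol kingVol_neZero)
open Summit.QuantumFields.YangMills.BalabanUVNodes.N15KingModelRung.Graph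

variable (L : ℕ)

/-! ## §1 The degree with derivative lines, and the two integer certificates -/

section Cert
variable {nn m : ℕ} {src tgt : Fin m → Fin (nn + 1)}

omit L in
/-- `D(S) = dd·(|V(S)| − 1) + (2 − dd)·|S| − #∂G(S)` for `G`∕`∂G` lines in `dd` dimensions. [cite: King1986, (3.63) p.663, (3.66) p.664] -/
theorem subDeg_lineExp_eq_card {dd : ℕ} (κ : Fin m → Option (Fin dd)) (S : Finset (Fin m)) :
    subDeg src tgt ((dd : ℕ) : ℝ) (fun ℓ => lineExp dd (κ ℓ)) S
      = ((dd : ℕ) : ℝ) * (((lineVerts src tgt S).card : ℝ) - 1) + ((2 : ℝ) - dd) * S.card - (dLines κ S : ℝ) := by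
  unfold subDeg
  rw [sum_lineExp_eq]
  ring

omit L in
/-- ★ **THE STRICT INTEGER CERTIFICATE WITH DERIVATIVE LINES GIVES KING's SUBGRAPH CONDITION** (`1 ≤ d`): if every non-empty line set has
`(d−1)·|S| + #∂G(S) + d + 2 ≤ (d+1)·|V(S)|`, then `PosSubgraphsBy src tgt 0 (d+1) (lineExp ∘ κ)`. [cite: King1986, p.664] -/
theorem posSubgraphsBy_lineExp_of_cert {d : ℕ} (hd1 : 1 ≤ d) {κ : Fin m → Option (Fin (d + 1))}
    (h : ∀ S : Finset (Fin m), S.Nonempty → (d - 1) * S.card + dLines κ S + d + 2 ≤ (d + 1) * (lineVerts src tgt S).card) :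
    PosSubgraphsBy src tgt 0 ((d + 1 : ℕ) : ℝ) (fun ℓ => lineExp (d + 1) (κ ℓ)) := by
  intro S hS _
  have h' := h S hS
  have hcast : (((d - 1 : ℕ) : ℝ)) = (d : ℝ) - 1 := by rw [Nat.cast_sub hd1, Nat.cast_one]
  have h'' : ((d : ℝ) - 1) * (S.card : ℝ) + (dLines κ S : ℝ) + d + 2 ≤ ((d : ℝ) + 1) * ((lineVerts src tgt S).card : ℝ) := by
    rw [← hcast]; exact_mod_cast h'
  rw [subDeg_lineExp_eq_card]
  push_cast
  nlinarith

omit L in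
/-- ★ **THE NON-STRICT CERTIFICATE GIVES NON-NEGATIVE SUBGRAPH DEGREES** (`1 ≤ d`): `(d−1)·|S| + #∂G(S) + d + 1 ≤ (d+1)·|V(S)|` for every non-empty `S` ⇒
`NonnegSubgraphs src tgt (d+1) (lineExp ∘ κ)`. [cite: King1986, p.664, (3.78) p.666] -/
theorem nonnegSubgraphs_lineExp_of_cert {d : ℕ} (hd1 : 1 ≤ d) {κ : Fin m → Option (Fin (d + 1))}
    (h : ∀ S : Finset (Fin m), S.Nonempty → (d - 1) * S.card + dLines κ S + d + 1 ≤ (d + 1) * (lineVerts src tgt S).card) :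
    NonnegSubgraphs src tgt ((d + 1 : ℕ) : ℝ) (fun ℓ => lineExp (d + 1) (κ ℓ)) := by
  intro S hS _
  have h' := h S hS
  have hcast : (((d - 1 : ℕ) : ℝ)) = (d : ℝ) - 1 := by rw [Nat.cast_sub hd1, Nat.cast_one]
  have h'' : ((d : ℝ) - 1) * (S.card : ℝ) + (dLines κ S : ℝ) + d + 1 ≤ ((d : ℝ) + 1) * ((lineVerts src tgt S).card : ℝ) := by
    rw [← hcast]; exact_mod_cast h'
  rw [subDeg_lineExp_eq_card]
  push_cast
  nlinarith

end Cert

/-! ## §2 Proposition 3.6 outright, and the size up to logarithms, from the certificates -/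

section FromCert
variable {d : ℕ} [NeZero L]

/-- ★★★ **KING 1986 PROPOSITION 3.6 (3.56) OUTRIGHT FOR CONNECTED GRAPHS OF `G`∕`∂G` LINES UNDER THE STRICT INTEGER CERTIFICATE** (`1 ≤ d`): part Δ-b
`king_prop36_graph_zeroField_subgraphs` with its hypothesis discharged by §1 — decidable for explicit graphs. [cite: King1986, Prop. 3.6 (3.56) p.662, p.664] -/
theorem king_prop36_graph_zeroField_mixedCert (hd1 : 1 ≤ d) (hLodd : Odd L) (hL : 2 ≤ L) {a : ℝ} (ha : 0 < a) {m0sq : ℝ} (hm0 : 0 ≤ m0sq) :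
    ∃ C₁ C₂ γ₀ : ℝ, 0 < C₁ ∧ 0 < C₂ ∧ 0 < γ₀ ∧ ∀ (msq : ℝ), 0 < msq → msq ≤ m0sq → ∀ (jv : KingVolIndex d) (n : ℕ), 1 ≤ n →
      ∀ (nn m : ℕ) (src tgt : Fin m → Fin (nn + 1)), (∀ v, LConn src tgt univ 0 v) →
      ∀ (κ : Fin m → Option (Fin (d + 1))),
        (∀ S : Finset (Fin m), S.Nonempty → (d - 1) * S.card + dLines κ S + d + 2 ≤ (d + 1) * (lineVerts src tgt S).card) →
      ∀ (Υ : Type) [Fintype Υ] [DecidableEq Υ]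
        (vtx : Υ → Fin (nn + 1)) (υ₀ : Υ), vtx υ₀ = 0 →
        haveI := kingVol_neZero L jv
        ∀ (u : Υ → Tor (fine (L ^ jv.K) (kingVol L jv)) → ℝ) (u' : Υ → Tor (fine (L ^ (jv.K + n)) (kingVol L jv)) → ℝ)
          (qq s : Υ → ℝ) (p₀ r₀ : Tor (fine (L ^ jv.K) (kingVol L jv)) → ℝ) (Γ Γ' : ℝ),
          (∀ υ, 0 ≤ qq υ) → (∀ υ, 0 ≤ s υ) → (∀ x, 0 ≤ r₀ x) →
          (∀ υ, υ ≠ υ₀ → ∀ x, |u υ x| ≤ qq υ) → (∀ υ, υ ≠ υ₀ → ∀ x', |u' υ x'| ≤ qq υ) →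
          (∀ υ, υ ≠ υ₀ → ∀ x', |u' υ x' - u υ (kingSlicePt L jv.K n (kingVol L jv) x')| ≤ s υ * qq υ) →
          (∀ x, |u υ₀ x| ≤ p₀ x) → (∀ x', |u' υ₀ x'| ≤ p₀ (kingSlicePt L jv.K n (kingVol L jv) x')) →
          (∀ x', |u' υ₀ x' - u υ₀ (kingSlicePt L jv.K n (kingVol L jv) x')| ≤ r₀ (kingSlicePt L jv.K n (kingVol L jv) x')) →
          (∑ x, (((L : ℝ) ^ jv.K)⁻¹) ^ (d + 1) * p₀ x ≤ Γ) → (∑ x, (((L : ℝ) ^ jv.K)⁻¹) ^ (d + 1) * r₀ x ≤ Γ') →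
            |graphValLS ((((L : ℝ) ^ (jv.K + n))⁻¹) ^ (d + 1)) src tgt (fun ℓ => kingGLine L (kingVol L jv) a msq (jv.K + n) (κ ℓ)) vtx u'
                - graphValLS ((((L : ℝ) ^ jv.K)⁻¹) ^ (d + 1)) src tgt (fun ℓ => kingGLine L (kingVol L jv) a msq jv.K (κ ℓ)) vtx u|
              ≤ (Γ' + Γ * ((L : ℝ) ^ (-(min γ₀ (1 / 4) * jv.K)) * (m + 1) + ∑ υ ∈ univ.erase υ₀, s υ))
                * (C₁ ^ m * C₂ ^ nn * ((m.factorial : ℝ) * ((1 - (L : ℝ) ^ (-(1 / 4 : ℝ)))⁻¹) ^ m) * ∏ υ ∈ univ.erase υ₀, qq υ) := by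
  obtain ⟨C₁, C₂, γ₀, hC₁, hC₂, hγ₀, H⟩ := king_prop36_graph_zeroField_subgraphs (d := d) L hLodd hL ha hm0
  refine ⟨C₁, C₂, γ₀, hC₁, hC₂, hγ₀, fun msq hm hcap jv n hn nn m src tgt hconn κ hcert Υ _ _ vtx υ₀ hυ₀ u u' qq s p₀ r₀ Γ Γ'
    hqq hs hr₀ hu hu' hus hp₀ hp₀' hr₀' hΓ hΓ' => ?_⟩
  exact H msq hm hcap jv n hn nn m src tgt hconn κ (posSubgraphsBy_lineExp_of_cert hd1 hcert) Υ vtx υ₀ hυ₀ u u' qq s p₀ r₀ Γ Γ'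
    hqq hs hr₀ hu hu' hus hp₀ hp₀' hr₀' hΓ hΓ'

/-- ★★★ **THE SIZE UP TO LOGARITHMS FOR CONNECTED GRAPHS OF `G`∕`∂G` LINES UNDER THE NON-STRICT CERTIFICATE** (`1 ≤ d`): part Λ-b
`king_graph_size_log_zeroField_subgraphs` with its hypothesis discharged by §1. [cite: King1986, p.664, (3.78)–(3.80) p.666] -/
theorem king_graph_size_log_zeroField_mixedCert (hd1 : 1 ≤ d) (hLodd : Odd L) (hL : 2 ≤ L) {a : ℝ} (ha : 0 < a) {m0sq : ℝ} (hm0 : 0 ≤ m0sq) :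
    ∃ C₁ C₂ : ℝ, 0 < C₁ ∧ 0 < C₂ ∧ ∀ (k eM : ℕ) (hk : 1 ≤ k) (M : Fin (d + 1) → ℕ) [∀ μ, NeZero (M μ)] (hM : ∀ μ, M μ = 2 * L ^ eM)
      (msq : ℝ), 0 < msq → msq ≤ m0sq →
      ∀ (n m : ℕ) (src tgt : Fin m → Fin (n + 1)), (∀ v, LConn src tgt univ 0 v) →
      ∀ (κ : Fin m → Option (Fin (d + 1))),
        (∀ S : Finset (Fin m), S.Nonempty → (d - 1) * S.card + dLines κ S + d + 1 ≤ (d + 1) * (lineVerts src tgt S).card) →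
      ∀ (Υ : Type) [Fintype Υ] [DecidableEq Υ] (vtx : Υ → Fin (n + 1)) (u : Υ → Tor (fine (L ^ k) M) → ℝ) (q : Υ → ℝ) (υ₀ : Υ) (Γ : ℝ),
        vtx υ₀ = 0 → (∀ υ, υ ≠ υ₀ → ∀ x, |u υ x| ≤ q υ) → (∑ x, (((L : ℝ) ^ k)⁻¹) ^ (d + 1) * |u υ₀ x| ≤ Γ) →
          |graphValLS ((((L : ℝ) ^ k)⁻¹) ^ (d + 1)) src tgt (fun ℓ => kingGLine L M a msq k (κ ℓ)) vtx u|
            ≤ Γ * (C₁ ^ m * C₂ ^ n * ((m.factorial : ℝ) * ((k : ℝ) + 1) ^ m) * ∏ υ ∈ univ.erase υ₀, q υ) := by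
  obtain ⟨C₁, C₂, hC₁, hC₂, H⟩ := king_graph_size_log_zeroField_subgraphs (d := d) L hLodd hL ha hm0
  refine ⟨C₁, C₂, hC₁, hC₂, fun k eM hk M _ hM msq hm hcap n m src tgt hconn κ hcert Υ _ _ vtx u q υ₀ Γ hυ₀ hq hΓ => ?_⟩
  exact H k eM hk M hM msq hm hcap n m src tgt hconn κ (nonnegSubgraphs_lineExp_of_cert hd1 hcert) Υ vtx u q υ₀ Γ hυ₀ hq hΓ

end FromCert

/-! ## §3 Two explicit graphs with a derivative line -/

section Examples
variable [NeZero L]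

/-- **THE TRIANGLE WITH ONE `∂G` LINE IS CERTIFIED IN FOUR DIMENSIONS** (`d = 3`: `2|S| + #∂G(S) + 5 ≤ 4|V(S)|` for all 7 non-empty line sets; the whole graph
`6 + 1 + 5 = 12 ≤ 12`, degree `4·2 − 2·3 − 1 = 1`), by `decide`. [cite: King1986, p.664] -/
theorem cert_dTriangle_three :
    ∀ S : Finset (Fin 3), S.Nonempty → (3 - 1) * S.card + dLines dTriKind S + 3 + 2 ≤ (3 + 1) * (lineVerts triSrc triTgt S).card := by decide

/-- ★★ **A GRAPH WITH A LOOP AND A DERIVATIVE LINE OBEYS (3.56) OUTRIGHT**: the triangle `{0,1}, {0,2}, {1,2}` with `{0,1}` a `∂G` line, in `d + 1 = 4`.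
[cite: King1986, Prop. 3.6 (3.56) p.662, p.664] -/
theorem king_prop36_graph_zeroField_dTriangle (hLodd : Odd L) (hL : 2 ≤ L) {a : ℝ} (ha : 0 < a) {m0sq : ℝ} (hm0 : 0 ≤ m0sq) :
    ∃ C₁ C₂ γ₀ : ℝ, 0 < C₁ ∧ 0 < C₂ ∧ 0 < γ₀ ∧ ∀ (msq : ℝ), 0 < msq → msq ≤ m0sq → ∀ (jv : KingVolIndex 3) (n : ℕ), 1 ≤ n →
      ∀ (Υ : Type) [Fintype Υ] [DecidableEq Υ]
        (vtx : Υ → Fin (2 + 1)) (υ₀ : Υ), vtx υ₀ = 0 →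
        haveI := kingVol_neZero L jv
        ∀ (u : Υ → Tor (fine (L ^ jv.K) (kingVol L jv)) → ℝ) (u' : Υ → Tor (fine (L ^ (jv.K + n)) (kingVol L jv)) → ℝ)
          (qq s : Υ → ℝ) (p₀ r₀ : Tor (fine (L ^ jv.K) (kingVol L jv)) → ℝ) (Γ Γ' : ℝ),
          (∀ υ, 0 ≤ qq υ) → (∀ υ, 0 ≤ s υ) → (∀ x, 0 ≤ r₀ x) →
          (∀ υ, υ ≠ υ₀ → ∀ x, |u υ x| ≤ qq υ) → (∀ υ, υ ≠ υ₀ → ∀ x', |u' υ x'| ≤ qq υ) →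
          (∀ υ, υ ≠ υ₀ → ∀ x', |u' υ x' - u υ (kingSlicePt L jv.K n (kingVol L jv) x')| ≤ s υ * qq υ) →
          (∀ x, |u υ₀ x| ≤ p₀ x) → (∀ x', |u' υ₀ x'| ≤ p₀ (kingSlicePt L jv.K n (kingVol L jv) x')) →
          (∀ x', |u' υ₀ x' - u υ₀ (kingSlicePt L jv.K n (kingVol L jv) x')| ≤ r₀ (kingSlicePt L jv.K n (kingVol L jv) x')) →
          (∑ x, (((L : ℝ) ^ jv.K)⁻¹) ^ (3 + 1) * p₀ x ≤ Γ) → (∑ x, (((L : ℝ) ^ jv.K)⁻¹) ^ (3 + 1) * r₀ x ≤ Γ') →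
            |graphValLS ((((L : ℝ) ^ (jv.K + n))⁻¹) ^ (3 + 1)) triSrc triTgt (fun ℓ => kingGLine L (kingVol L jv) a msq (jv.K + n) (dTriKind ℓ)) vtx u'
                - graphValLS ((((L : ℝ) ^ jv.K)⁻¹) ^ (3 + 1)) triSrc triTgt (fun ℓ => kingGLine L (kingVol L jv) a msq jv.K (dTriKind ℓ)) vtx u|
              ≤ (Γ' + Γ * ((L : ℝ) ^ (-(min γ₀ (1 / 4) * jv.K)) * (((3 : ℕ) : ℝ) + 1) + ∑ υ ∈ univ.erase υ₀, s υ))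
                * (C₁ ^ 3 * C₂ ^ 2 * (((Nat.factorial 3 : ℕ) : ℝ) * ((1 - (L : ℝ) ^ (-(1 / 4 : ℝ)))⁻¹) ^ 3) * ∏ υ ∈ univ.erase υ₀, qq υ) := by
  obtain ⟨C₁, C₂, γ₀, hC₁, hC₂, hγ₀, H⟩ := king_prop36_graph_zeroField_mixedCert (d := 3) L (by norm_num) hLodd hL ha hm0
  refine ⟨C₁, C₂, γ₀, hC₁, hC₂, hγ₀, fun msq hm hcap jv n hn Υ _ _ vtx υ₀ hυ₀ u u' qq s p₀ r₀ Γ Γ'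
    hqq hs hr₀ hu hu' hus hp₀ hp₀' hr₀' hΓ hΓ' => ?_⟩
  exact H msq hm hcap jv n hn 2 3 triSrc triTgt lConn_triangle dTriKind cert_dTriangle_three Υ vtx υ₀ hυ₀ u u' qq s p₀ r₀ Γ Γ'
    hqq hs hr₀ hu hu' hus hp₀ hp₀' hr₀' hΓ hΓ'

/-- **KING's `G∂G` BUBBLE HAS NON-NEGATIVE SUBGRAPH DEGREES IN THREE DIMENSIONS** (`d = 2`: `|S| + #∂G(S) + 3 ≤ 3|V(S)| = 6`: `{G}`: `4`, `{∂G}`: `5`, both: `6`;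
degrees `2, 1, 0`), by `decide`. [cite: King1986, p.664, (3.81) p.667] -/
theorem nonnegCert_GdG_two :
    ∀ S : Finset (Fin 2), S.Nonempty → (2 - 1) * S.card + dLines gdgKind S + 2 + 1 ≤ (2 + 1) * (lineVerts bubSrc bubTgt S).card := by decide

/-- ★★ **KING's THREE-DIMENSIONAL `G∂G` BUBBLE IS BOUNDED BY `const·(k+1)²`** (`d = 2`): one `G` and one `∂G` line in parallel between the external vertex and one
internal vertex — degree `3 − 1 − 2 = 0` (part Δ-c's negative census) — `|E^{(k)}| ≤ Γ·C₁²·C₂·(2!·(k+1)²)·Π q`. [cite: King1986, p.666, (3.81) p.667] -/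
theorem king_graph_size_log_GdG (hLodd : Odd L) (hL : 2 ≤ L) {a : ℝ} (ha : 0 < a) {m0sq : ℝ} (hm0 : 0 ≤ m0sq) :
    ∃ C₁ C₂ : ℝ, 0 < C₁ ∧ 0 < C₂ ∧ ∀ (k eM : ℕ) (hk : 1 ≤ k) (M : Fin (2 + 1) → ℕ) [∀ μ, NeZero (M μ)] (hM : ∀ μ, M μ = 2 * L ^ eM)
      (msq : ℝ), 0 < msq → msq ≤ m0sq →
      ∀ (Υ : Type) [Fintype Υ] [DecidableEq Υ] (vtx : Υ → Fin (1 + 1)) (u : Υ → Tor (fine (L ^ k) M) → ℝ) (q : Υ → ℝ) (υ₀ : Υ) (Γ : ℝ),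
        vtx υ₀ = 0 → (∀ υ, υ ≠ υ₀ → ∀ x, |u υ x| ≤ q υ) → (∑ x, (((L : ℝ) ^ k)⁻¹) ^ (2 + 1) * |u υ₀ x| ≤ Γ) →
          |graphValLS ((((L : ℝ) ^ k)⁻¹) ^ (2 + 1)) bubSrc bubTgt (fun ℓ => kingGLine L M a msq k (gdgKind ℓ)) vtx u|
            ≤ Γ * (C₁ ^ 2 * C₂ ^ 1 * (((Nat.factorial 2 : ℕ) : ℝ) * ((k : ℝ) + 1) ^ 2) * ∏ υ ∈ univ.erase υ₀, q υ) := by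
  obtain ⟨C₁, C₂, hC₁, hC₂, H⟩ := king_graph_size_log_zeroField_mixedCert (d := 2) L (by norm_num) hLodd hL ha hm0
  refine ⟨C₁, C₂, hC₁, hC₂, fun k eM hk M _ hM msq hm hcap Υ _ _ vtx u q υ₀ Γ hυ₀ hq hΓ => ?_⟩
  exact H k eM hk M hM msq hm hcap 1 2 bubSrc bubTgt lConn_bubble gdgKind nonnegCert_GdG_two Υ vtx u q υ₀ Γ hυ₀ hq hΓ

end Examples

end Summit.QuantumFields.YangMills.BalabanUVNodes.N15KingModelRung.Curved

end
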